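import Summits.ResolutionOfSingularities.ResolutionOfSingularities.Theorems.SpreadCutLaw4
import HarnessLib

/-!
# SpreadCutCells — decomp-res node «SpreadCut» (lens-2 g19)

Content VERBATIM from the decomp-res lens-2 g19 node `HOME/decomp-res-lens-2/g19/SpreadCut.lean` (pin b2959d31, 3
579 l; HOME = run/shared/lean/pub/decomp-res);
CRITIC-LEDGER row 155 (DECIDED-MOD-PORT +1); landing orders INBOX :540: l. 143–2878 are `CylinderCut` d60dded1
VERBATIM (landed as `CylinderCutClasses` · `CylinderCutCells` ·
`MaxContactCutCylinderCut`) and are DELETED here with the landed modules imported instead (namespaces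
`…Theorems.PinchCut` / `JetCut` / `PurityCut` / `SplitCut` / `CylinderCut`
opened; same short names, byte-identical bodies — never two copies); NEW = §Γ (l. 2880–3336, the ring-level law +
§Γ.3 point level) and §V (l. 3338–3576, the spread cut).
Namespace `…Theorems.SpreadCut` (the lens's `Theses.SpreadCut` is gate-reserved), sub-namespace `Spread` as in the
lens; file split only (tree files ≤ 400 lines): sections,
variables, the `open MvPolynomial` lines and every declaration exactly as in the lens; the node's global
dupNamespace-linter line dropped.  Node files, in import order:
`SpreadCutLaw` (§Γ + the cone-free head of §V; continued `…2` / `…3` where the cap cuts) · `SpreadCutCells` (§V2–§V4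
cone-free: the aside home) · the wiring `MaxContactCutSpreadCut`
(§V BY NAME on the host route, in the Theses cone).  All `--supports stmt-ResolutionOfSingularities-29273`
(`MaxContactCut.RungOne`); nothing closes 29273 — decided halves
carry their engines as hypotheses (`SpreadExit` is a paper engine, not an item); exactly ONE located-residual aside
on the lens-2 column (`Spread.SpreadSpecialRung`, home
`SpreadCutCells`) SUPERSEDES g18's `Cyl.CylSpecialRung`, re-located EXACTLY modulo the spread decided half.

§V2–§V4 cone-free part — `namespace Spread`: the graded statements, the rungs **`SpreadGenericRung`** (DECIDED half,
engines/ports as hypotheses) / **`SpreadSpecialRung`** (THE LOCATED RESIDUAL of the node — the ONE aside on the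
lens-2 column, SUPERSEDING g18's `Cyl.CylSpecialRung`), their `…_iff` with the §G `Leaf` schema and the
hypothesis-free links — statement-level + pure logic; this module is the cone-free aside home.  The cut BY NAME on
the route (`Spread.rungOne_iff`, `Spread.closes`, `spreadGenericRung_of_ports`, `closes_of_engines`,
`cylSpecialRung_iff_spreadSpecialRung` + the chain of earlier re-locations) is in `MaxContactCutSpreadCut`.

(Sources: Hironaka1964 Ch. III; CossartJannsenSaito2020 Ch. 2, Ch. 8–9; CossartPiltant2008 Prop. 4.2;
CossartPiltant2019 Rem. 3.2; BierstoneGrigorievMilmanWlodarczyk2011 §3.1; Moh1987; Hauser2010Kangaroo; Giraud1975;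
Narasimhan1983.)
-/

open CategoryTheory AlgebraicGeometry TopologicalSpace IsLocalRing
open Literature.AlgebraicGeometry.Resolution
open Summit.ResolutionOfSingularities.ResolutionOfSingularities.Theorems
open Summit.ResolutionOfSingularities.ResolutionOfSingularities.Theorems.WeakOrderReduction
open Summit.ResolutionOfSingularities.ResolutionOfSingularities.Theorems.DeltaFaceCutClasses
open Summit.ResolutionOfSingularities.ResolutionOfSingularities.Theorems.RelativeDeltaCut
open Summit.ResolutionOfSingularities.ResolutionOfSingularities.Theorems.CurveLeafExit
open Summit.ResolutionOfSingularities.ResolutionOfSingularities.Theorems.PinchCut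
open Summit.ResolutionOfSingularities.ResolutionOfSingularities.Theorems.JetCut
open Summit.ResolutionOfSingularities.ResolutionOfSingularities.Theorems.PurityCut
open Summit.ResolutionOfSingularities.ResolutionOfSingularities.Theorems.SplitCut
open Summit.ResolutionOfSingularities.ResolutionOfSingularities.Theorems.CylinderCut
open MvPolynomial

namespace Summit.ResolutionOfSingularities.ResolutionOfSingularities.Theorems.SpreadCut

namespace Spread

/-! ### §V2  The graded statements of the SPREAD cut (instances of §G with the spread leaf) -/

/-- **`SeqSGen n`** — weak order reduction in dimension four at marking `n` for data ALL of whose top points are in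
the decided classes
of g18 or SPREAD-CURVE points.  [DECIDED-MOD-PORT: `sGenRungAt_of_engines`.]  STATEMENT SCHEMA (= `Leaf.SeqGen
spreadLeaf n`). (Sources: BierstoneGrigorievMilmanWlodarczyk2011 §3.1; CossartPiltant2008 Prop. 4.2; Hironaka1967.) -/
def SeqSGen (n : ℕ) : Prop := Leaf.SeqGen spreadLeaf n

/-- **`SeqSSpec n`** — THE LOCATED CLASS: weak order reduction at marking `n` for data having a SPREAD-SPECIAL core top point.
[UNDECIDED · IDEA-NEEDED.]  STATEMENT SCHEMA (= `Leaf.SeqSpec spreadLeaf n`). (Sources: CossartPiltant2019 Rem. 3.2;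
Moh1987.) -/
def SeqSSpec (n : ℕ) : Prop := Leaf.SeqSpec spreadLeaf n

/-- `SGenRungAt n` — the decided rung at one marking. -/
def SGenRungAt (n : ℕ) : Prop := SeqDimFour 2 n → SeqSGen n

/-- **`SpreadGenericRung`** — the DECIDED half of `RungOne` (29273) for the spread leaf.  [WEAKER · DECIDED-MOD-PORT(M+):
`spreadGenericRung_of_ports`.]  STATEMENT (decided piece). (Sources: Hironaka1967; CossartPiltant2008 Prop. 4.2;
CossartJannsenSaito2020.) -/
def SpreadGenericRung : Prop := E 2 → ∀ n : ℕ, 1 ≤ n → SeqSGen n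

/-- **`SpreadSpecialRung`** — THE LOCATED RESIDUAL of this node: `E 2 →` weak order reduction for every marking and
all data with a
spread-special core top point.  [WEAKER BY LETTER than `Cyl.CylSpecialRung` · UNDECIDED · IDEA-NEEDED · cofinal ⇒ score 0.]
STATEMENT (located residual). (Sources: CossartPiltant2019 Rem. 3.2; Moh1987; Giraud1975; Narasimhan1983.) -/
def SpreadSpecialRung : Prop := E 2 → ∀ n : ℕ, 1 ≤ n → SeqSSpec n

/-- `spreadGenericRung_iff`: Auxiliary step of this node's calculus, VERBATIM from the lens file (see the module
docstring); the statement is its type. [folklore] -/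
theorem spreadGenericRung_iff : SpreadGenericRung ↔ Leaf.GenericRung spreadLeaf := Iff.rfl

/-- `spreadSpecialRung_iff`: Auxiliary step of this node's calculus, VERBATIM from the lens file (see the module
docstring); the statement is its type. [folklore] -/
theorem spreadSpecialRung_iff : SpreadSpecialRung ↔ Leaf.SpecialRung spreadLeaf := Iff.rfl

section Kernels

variable {n : ℕ}

/-! ### §V3  Kernels of the SPREAD cut (instantiated from §G; 0 sorry) -/

/-- **EXACT at each marking**: `SeqDimFour 1 n ⟺ SeqSGen n ∧ SeqSSpec n`. [folklore] -/
theorem seqDimFour_one_iff : SeqDimFour 1 n ↔ SeqSGen n ∧ SeqSSpec n :=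
  Leaf.seqDimFour_one_iff (L := spreadLeaf)

/-- Under the engines (M) (C) (G) (S) (Cyl) (JCyl) (Γ) every point of the spread leaf is a curve-exit point. [folklore] -/
theorem isCurveExitPt_of_spreadLeaf (hM : MonomialPinchExit) (hC : FlatConeExit) (hGE : GrandExit) (hSE : SplitConeExit)
    (hCE : CylinderExit) (hJE : JetCylinderExit) (hΓE : SpreadExit)
    (hn : 2 ≤ n) ⦃Y : Scheme.{0}⦄ (hY : Scheme.IsRegular Y) ⦃I : Y.IdealSheafData⦄ ⦃y : Y⦄ (h : spreadLeaf I n y) :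
    IsCurveExitPt I n y := by
  rcases h with h | h
  · exact Cyl.isCurveExitPt_of_cylLeaf hM hC hGE hSE hCE hJE hn hY h
  · exact isCurveExitPt_of_isSpreadCurvePt hΓE hY hn h

/-- **THE ENGINES AT WORK**: the five tree engines, (M) (C) (G) (S) (Cyl) (JCyl), the NEW engine (Γ) and g12's port
give `SGenRungAt n`
for `n ≥ 2`. [folklore] -/
theorem sGenRungAt_of_engines (hV : VeryNearCutClasses.VeryNearExit) (hD : DeltaPackageExit)
    (hU : UniformCurvePackageExit) (hR : RelCurvePackageExit) (hN : NormalConeJumpExit)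
    (hM : MonomialPinchExit) (hC : FlatConeExit) (hGE : GrandExit) (hSE : SplitConeExit)
    (hCE : CylinderExit) (hJE : JetCylinderExit) (hΓE : SpreadExit) (hP : CurvePackagePort n) (hn : 2 ≤ n) : SGenRungAt n :=
  Leaf.genRungAt_of_port (L := spreadLeaf) hV hD hU hR hN (isCurveExitPt_of_spreadLeaf hM hC hGE hSE hCE hJE hΓE hn) hP hn

/-- **`SpreadGenericRung` is DECIDED modulo the typed pieces**: engines (as hypotheses), g12's port at every marking
`≥ 2`, the order-one
contact port. [folklore] -/
theorem spreadGenericRung_of_engines (hV : VeryNearCutClasses.VeryNearExit) (hD : DeltaPackageExit)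
    (hU : UniformCurvePackageExit) (hR : RelCurvePackageExit) (hN : NormalConeJumpExit)
    (hM : MonomialPinchExit) (hC : FlatConeExit) (hGE : GrandExit) (hSE : SplitConeExit)
    (hCE : CylinderExit) (hJE : JetCylinderExit) (hΓE : SpreadExit)
    (hP : ∀ n : ℕ, 2 ≤ n → CurvePackagePort n) (h1 : FaceFormCutClasses.OrderOneContact) : SpreadGenericRung :=
  Leaf.genericRung_of_port (L := spreadLeaf) hV hD hU hR hN
    (fun _ hn => isCurveExitPt_of_spreadLeaf hM hC hGE hSE hCE hJE hΓE hn) hP h1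

/-! ### §V4  EXACT RE-LOCATIONS (the residual shrinks; equivalent modulo the spread decided half) -/

/-- **REFINEMENT EDGE (hypothesis-free)**: g18's residual implies g19's — `Cyl.CylSpecialRung → SpreadSpecialRung`
(WEAKER BY LETTER).
[folklore] -/
theorem spreadSpecialRung_of_cylSpecialRung (h : Cyl.CylSpecialRung) : SpreadSpecialRung :=
  Leaf.specialRung_mono cylLeaf_le_spreadLeaf (Cyl.cylSpecialRung_iff.mp h)

/-- The spread decided half contains g18's: `SpreadGenericRung → Cyl.CylGenericRung`. [folklore] -/
theorem cylGenericRung_of_spreadGenericRung (h : SpreadGenericRung) : Cyl.CylGenericRung :=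
  Cyl.cylGenericRung_iff.mpr (Leaf.genericRung_anti cylLeaf_le_spreadLeaf h)

end Kernels

end Spread

end Summit.ResolutionOfSingularities.ResolutionOfSingularities.Theorems.SpreadCut
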